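import Summits.QuantumFields.YangMills.Theorems.BalabanUVNodesN20OverAgeRefreshProcess
import Summits.QuantumFields.YangMills.Theorems.BalabanUVNodesN19TameConditionedHellingerLetterAlongK

/-!
# BalabanUVNodes ∕ node N20 (NE7b) — THE (V‑a) BINDER FROM AN ABSTRACT REFRESH PROCESS, FILE 2 of 2: AT THE CLASS WEIGHTS OF A KEY — the refresh-process letters of the
# two runs DISCHARGE the `wm` binders of dag-n19-w4's `affinityDefectLetter_of_tameTilts` (p618979) BY NAME: refresh processes + tame tilts ⇒ the (H) letter; the SHAPE of the
# modelling letter from a down-closed factorising weight system (Peierls domination); toys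

Cell `pub-ymgap` (HUMAN RULING D-0062 Track A ∕ director-ym R399 (3a) second-wave width seats), WIDTH SEAT `pub-ymgap-dag-n20-w5` (node n20 = NE7b),
generation g4, CLAIM-1 ∕ INTENT-1 (bus 2026-08-28T09:11:40Z; 400-line split, FILE 2 of 2).  Key item K3⁷ `SpineGivenEndpointR13SepCoPH` (stmt-QuantumFields-20544;
skeleton of record v5 941dddb108cbaacf, stub 2 `stub_expansion13H`); filed `--kind proof --supports … --as helper`.  COUNT-NEUTRAL.  THEOREMS ONLY (0 `def`,
0 `instance`, 0 `notation`, 0 `sorry`).  ADDITIVE — imports FILE 1 `…N20OverAgeRefreshProcess` (`wildMass_summable_of_refreshProcess`, `wildMass_summable_pair`) and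
dag-n19-w4 g6's `…N19TameConditionedHellingerLetterAlongK` (p618979; `affinityDefectLetter_of_tameTilts`, `exists_summable_sqrt_rate` BY NAME); modifies nothing.

WHAT.
* §5 ★ `classWildMass_summable_of_refreshProcess` — ONE run: on the carrier shapes of the key (`T : ℕ → Finset ι`, class weights `A : ℕ → ℝ → ι → ℝ` positive on
  `|t| ≤ l₀`, wild sets `W K t ⊆ T K`) the refresh-process letters of FILE 1 with the MODELLING letter stated for the relative wild mass `Σ_{W K t} A ∕ Σ_{T K} A`
  give EXACTLY p618979's binders `(wm, hwm, hwildA, hws)` (the a-priori `≤ 1` is automatic).  ★★★ `affinityDefectLetter_of_refreshProcesses_and_tameTilts` — TWO runs: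
  refresh-process letters for run A and run B (common scalars `θ Λ ζ κ₁ Z₀ C₀ b`, `κ₁(θ − Λ − ζ) > 2`) + p618979's tame-tilt letters VERBATIM (radii `Σ 1∕r_K < ∞`,
  ONE bound `𝔅`, analytic tilts of the TAME-RESTRICTED class sums, tame regime from `K₀`) ⇒ p618979's (H) letter `∃ η ≥ 0, Σ√η_K < ∞,
  1 − Σ_{T K}√(p_{A,K,t}·p_{B,K,t}) ≤ η_K` — the `hH` + `hηs` inputs of this seat's p619159 `target_of_endpointResponse` ∕ `classLawTV_of_affinityDefect` (and, given
  `η_K < ½`, of `exists_hybridNE7_of_endpointLetters`); ★ `hellingerRate_of_refreshProcesses_and_tameTilts` — the ρ-shape (`∃ ρ` summable, `√(1 − 𝒜_K(t)) ≤ ρ_K`).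
* §7 [folklore: Peierls ∕ polymer-gas inequality] THE SHAPE OF `hmodel` AT ONE BIRTH DEPTH (idea-3 g14's sketch ed.3 §14.9, re-proved def-free): one run's keyed class
  weights RELATIVE to the small-field background read ((KR)) as a weight system `A ≥ 0` on a DOWN-CLOSED family `𝒜` of refresh-event sets with the FACTORISATION-WITH-DEFICIT
  letter `A X ≤ (Π_{γ∈S} w γ)·A (X ∖ S)`; ★ `sum_superset_le_prod_mul_sum` (one pattern), `sum_exists_superset_le` (a pattern family), ★★ `overagedMass_le_patternSum_mul` and
  ★ `overagedRelMass_le_patternSum` — with the PENDENCY containment «over-aged ⇒ contains a covering refresh pattern» the relative over-aged mass is `≤` the pattern sum;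
  what then stays lettered on the (V‑a) side is exactly: the representation, the containment, and the depth bookkeeping `C₀·e^{Λm}` — three one-page questions.
* §6 toys (A6): the empty process has pattern sum `0` at positive over-age and `1` at over-age `0`; the rate ∕ entropy ∕ block letters of FILE 1 are jointly inhabited
  with room (`L = 2`, `θ = 10`, `P = 20`, `ζ = e^{−10}`, `κ₁ = 1`); `toy_product_factorises` (pure product weights satisfy §7's letter with equality).
READING (located, nothing proposed).  (i) With FILE 1 + this file + p618979 + dag-n19-w4's announced §12 (`…N19TameTiltLetterOfKPMargin`, the `htilt` binder from a
one-run KP margin) the V-side chain «(V‑a) refresh letters + (KR)+(V‑b) KP margins ⇒ (H)» of the card is importable end to end MODULO its named letters; the R-side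
((R′), (R‑c)) enters only at p619159.  (ii) The two runs' processes share the scalars `θ Λ ζ κ₁ Z₀ C₀ b` here; a consumer holding different scalars per run takes
the worse of each (monotone in every letter) — not typed.  (iii) `hmodel` is where the MODELLING step (KR on histories, positions `e^{Λm}`, birth density `C₀`) lives.

HONEST FRAMING.  [folklore] finite-sum real analysis + by-name transfer through FILE 1 and p618979; EVERY refresh-process letter and the MODELLING inequality are
HYPOTHESES produced by nobody — their truth for Bałaban's kernels is idea-3 g13's READING of [LF‑II] (1.79)–(1.85) (derived on paper, re-priced located A∧B by
CRIT-1 g6), NOT asserted, NOT kernel; (KR) on tame components, the tame tilts, the radii (`Σ 1∕r_K < ∞` = (V‑b) = (YG), two-run, UNPRINTED for d = 4) and the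
regime are p618979's hypotheses, unchanged.  NO estimate of Bałaban's programme is proved; nothing of Bałaban's asserted or instantiated (no `Provisos₁₃CoPH` tuple —
K0⁷ OPEN); NE7 ∕ NE7b ∕ NE7c NOT PRINTED as two-run statements for d = 4 and NOT proved; N19 ∕ N20 ∕ N21 NOT discharged; K3⁷ OPEN, v5 STANDS, not claimed; no
summit statement is proved by this seat; counts UNMOVED (typed 28∕28 · discharged 5∕27, A 5∕28).  One finite four-torus programme at fixed ε — NOT ℝ⁴, NOT
infinite volume, NOT OS, NOT a mass gap, NOT the Clay problem (R4 closes the conditional finite-𝕋⁴ rung `BalabanLadder.UV` only).  0 `def`; 0 `sorry`; standard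
axioms; no cite tags.
-/

noncomputable section

namespace Summit.QuantumFields.YangMills.BalabanUVNodes.N20OverAgeRefreshProcessAtClassWeights

open Finset
open Summit.QuantumFields.YangMills.BalabanUVNodes.N20OverAgeRefreshProcess (wildMass_summable_of_refreshProcess wildMass_summable_pair)
open Summit.QuantumFields.YangMills.BalabanUVNodes.N19TameConditionedHellingerLetterAlongK
  (affinityDefectLetter_of_tameTilts exists_summable_sqrt_rate)

variable {α : Type*}

/-! ## §5 At the class weights of a key: the refresh-process letters DISCHARGE the `wm` binders of p618979, BY NAME -/

section ClassWeights
variable {ι : Type*} [DecidableEq ι] {l₀ : ℝ}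

omit [DecidableEq ι] in
/-- **★ ONE RUN's WILD CLASS MASS FROM ITS REFRESH PROCESS** [folklore].  On the carrier shapes of the key (`T : ℕ → Finset ι`, class weights `A : ℕ → ℝ → ι → ℝ`
positive on `|t| ≤ l₀`, wild sets `W K t ⊆ T K`), the refresh-process letters of `wildMass_summable_of_refreshProcess` with the MODELLING letter stated for the relative
wild mass `Σ_{W K t} A ∕ Σ_{T K} A` give EXACTLY the binders `(wm, hwm, hwildA, hws)` of p618979's `affinityDefectLetter_of_tameTilts` ∕ `hellingerRate_of_tameTilts`
(the a-priori bound `≤ 1` is automatic: `W ⊆ T`, positive weights). -/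
theorem classWildMass_summable_of_refreshProcess (T : ℕ → Finset ι) (A : ℕ → ℝ → ι → ℝ)
    (hA : ∀ K t, |t| ≤ l₀ → ∀ τ ∈ T K, 0 < A K t τ)
    (W : ℕ → ℝ → Finset ι) (hW : ∀ K t, W K t ⊆ T K)
    {θ Λ ζ κ₁ Z₀ C₀ : ℝ} (b : ℝ) (hθ : 0 ≤ θ) (hΛθ : Λ + ζ < θ) (hκ : 2 < κ₁ * (θ - Λ - ζ)) (hC₀ : 0 ≤ C₀)
    (U : ℕ → ℝ → ℕ → Finset α) (w ℓ P : ℕ → ℝ → ℕ → α → ℝ)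
    (hw0 : ∀ K t m, ∀ j ∈ U K t m, 0 ≤ w K t m j)
    (hw : ∀ K t m, ∀ j ∈ U K t m, w K t m j ≤ Real.exp (-P K t m j))
    (hθP : ∀ K t m, ∀ j ∈ U K t m, θ * ℓ K t m j ≤ P K t m j / 2)
    (hZ : ∀ K t (m : ℕ), ∑ j ∈ U K t m, Real.exp (-(P K t m j / 2)) ≤ Z₀ + ζ * m)
    (hmodel : ∀ (K : ℕ) (t : ℝ), |t| ≤ l₀ → 1 ≤ K → ∀ s : ℝ,
      (∀ M : ℕ, ∑ m ∈ range M, (if b + κ₁ * Real.log (K : ℝ) ≤ (m : ℝ) then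
          Real.exp (Λ * m) * ∑ S ∈ (U K t m).powerset with ((m : ℝ) - b ≤ ∑ j ∈ S, ℓ K t m j), ∏ j ∈ S, w K t m j
        else 0) ≤ s) →
      (∑ τ ∈ W K t, A K t τ) / (∑ σ ∈ T K, A K t σ) ≤ C₀ * s) :
    ∃ wm : ℕ → ℝ, (∀ K, 0 ≤ wm K) ∧ Summable (fun K => Real.sqrt (wm K)) ∧
      ∀ K t, |t| ≤ l₀ → (∑ τ ∈ W K t, A K t τ) / (∑ σ ∈ T K, A K t σ) ≤ wm K := by
  refine wildMass_summable_of_refreshProcess (fun K t => (∑ τ ∈ W K t, A K t τ) / (∑ σ ∈ T K, A K t σ))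
    (fun K t ht => ?_) b hθ hΛθ hκ hC₀ U w ℓ P hw0 hw hθP hZ hmodel
  have hle : ∑ τ ∈ W K t, A K t τ ≤ ∑ σ ∈ T K, A K t σ :=
    sum_le_sum_of_subset_of_nonneg (hW K t) fun σ hσ _ => (hA K t ht σ hσ).le
  exact div_le_one_of_le₀ hle (sum_nonneg fun σ hσ => (hA K t ht σ hσ).le)

/-- **★★★ THE (H) LETTER FROM TWO REFRESH PROCESSES AND TAME TILTS — §14 ∘ §13, IMPORTABLE** [folklore; junction BY NAME with p618979
`affinityDefectLetter_of_tameTilts`].  On the carrier shapes of the key: positive class weights `A, B` of the two runs on `|t| ≤ l₀`, wild sets `W K t ⊆ T K`;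
for EACH run an abstract refresh process (event sets, factors `≤ e^{−P}`, epoch lengths, entropy `Z₀ + ζm`) with common scalars — rate `θ ≥ 0` (`θ·ℓ ≤ P∕2`), block
entropy `Λ` (`Λ + ζ < θ`), budget `b`, age-margin slope `κ₁` with `κ₁(θ − Λ − ζ) > 2`, constant `C₀ ≥ 0` — and its MODELLING letter for that run's relative wild
mass ((V‑a), READ on paper, produced by nobody); p618979's tame-tilt letters — radii `r_K > 0` with `Σ 1∕r_K < ∞` ((V‑b) = (YG)), ONE bound `𝔅`, the analytic tilts of
the TAME-RESTRICTED class sums ((KR) on tame components), the tame regime from `K₀` on.  Conclusion: p618979's (H) letter — `∃ η ≥ 0`, `Σ_K √η_K < ∞`,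
`1 − Σ_{T K} √(p_{A,K,t}·p_{B,K,t}) ≤ η_K` for all `K`, `|t| ≤ l₀` — the `hH` + `hηs` inputs of this seat's p619159 `target_of_endpointResponse` ∕
`classLawTV_of_affinityDefect` (and, given `η_K < ½`, of `exists_hybridNE7_of_endpointLetters`). -/
theorem affinityDefectLetter_of_refreshProcesses_and_tameTilts (T : ℕ → Finset ι) (A B : ℕ → ℝ → ι → ℝ)
    (hA : ∀ K t, |t| ≤ l₀ → ∀ τ ∈ T K, 0 < A K t τ) (hB : ∀ K t, |t| ≤ l₀ → ∀ τ ∈ T K, 0 < B K t τ)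
    (W : ℕ → ℝ → Finset ι) (hW : ∀ K t, W K t ⊆ T K)
    -- the refresh processes of the two runs (common scalars)
    {θ Λ ζ κ₁ Z₀ C₀ : ℝ} (b : ℝ) (hθ : 0 ≤ θ) (hΛθ : Λ + ζ < θ) (hκ : 2 < κ₁ * (θ - Λ - ζ)) (hC₀ : 0 ≤ C₀)
    (UA UB : ℕ → ℝ → ℕ → Finset α) (wA ℓA PA wB ℓB PB : ℕ → ℝ → ℕ → α → ℝ)
    (hwA0 : ∀ K t m, ∀ j ∈ UA K t m, 0 ≤ wA K t m j) (hwB0 : ∀ K t m, ∀ j ∈ UB K t m, 0 ≤ wB K t m j)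
    (hwA : ∀ K t m, ∀ j ∈ UA K t m, wA K t m j ≤ Real.exp (-PA K t m j))
    (hwB : ∀ K t m, ∀ j ∈ UB K t m, wB K t m j ≤ Real.exp (-PB K t m j))
    (hθPA : ∀ K t m, ∀ j ∈ UA K t m, θ * ℓA K t m j ≤ PA K t m j / 2)
    (hθPB : ∀ K t m, ∀ j ∈ UB K t m, θ * ℓB K t m j ≤ PB K t m j / 2)
    (hZA : ∀ K t (m : ℕ), ∑ j ∈ UA K t m, Real.exp (-(PA K t m j / 2)) ≤ Z₀ + ζ * m)
    (hZB : ∀ K t (m : ℕ), ∑ j ∈ UB K t m, Real.exp (-(PB K t m j / 2)) ≤ Z₀ + ζ * m)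
    (hmodelA : ∀ (K : ℕ) (t : ℝ), |t| ≤ l₀ → 1 ≤ K → ∀ s : ℝ,
      (∀ M : ℕ, ∑ m ∈ range M, (if b + κ₁ * Real.log (K : ℝ) ≤ (m : ℝ) then
          Real.exp (Λ * m) * ∑ S ∈ (UA K t m).powerset with ((m : ℝ) - b ≤ ∑ j ∈ S, ℓA K t m j), ∏ j ∈ S, wA K t m j
        else 0) ≤ s) →
      (∑ τ ∈ W K t, A K t τ) / (∑ σ ∈ T K, A K t σ) ≤ C₀ * s)
    (hmodelB : ∀ (K : ℕ) (t : ℝ), |t| ≤ l₀ → 1 ≤ K → ∀ s : ℝ,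
      (∀ M : ℕ, ∑ m ∈ range M, (if b + κ₁ * Real.log (K : ℝ) ≤ (m : ℝ) then
          Real.exp (Λ * m) * ∑ S ∈ (UB K t m).powerset with ((m : ℝ) - b ≤ ∑ j ∈ S, ℓB K t m j), ∏ j ∈ S, wB K t m j
        else 0) ≤ s) →
      (∑ τ ∈ W K t, B K t τ) / (∑ σ ∈ T K, B K t σ) ≤ C₀ * s)
    -- p618979's tame-tilt letters, verbatim
    (r : ℕ → ℝ) (hr : ∀ K, 0 < r K) (hrs : Summable fun K => 1 / r K)
    {𝔅 : ℝ} (h𝔅 : 0 ≤ 𝔅)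
    (htilt : ∀ K t, |t| ≤ l₀ → ∃ φA φB : ℂ → ℂ,
      DifferentiableOn ℂ φA (Metric.closedBall 0 (r K)) ∧ DifferentiableOn ℂ φB (Metric.closedBall 0 (r K)) ∧
      (∀ s ∈ Metric.closedBall (0:ℂ) (r K), Complex.exp (φA s)
        = (∑ τ ∈ T K \ W K t, (A K t τ : ℂ) * Complex.exp (s * ((Real.log (B K t τ) - Real.log (A K t τ) : ℝ) : ℂ)))
            / ∑ τ ∈ T K \ W K t, (A K t τ : ℂ)) ∧
      (∀ s ∈ Metric.closedBall (0:ℂ) (r K), Complex.exp (φB s)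
        = (∑ τ ∈ T K \ W K t, (B K t τ : ℂ) * Complex.exp (s * ((Real.log (B K t τ) - Real.log (A K t τ) : ℝ) : ℂ)))
            / ∑ τ ∈ T K \ W K t, (B K t τ : ℂ)) ∧
      (∀ s ∈ Metric.closedBall (0:ℂ) (r K), ‖φA s‖ ≤ 𝔅) ∧ (∀ s ∈ Metric.closedBall (0:ℂ) (r K), ‖φB s‖ ≤ 𝔅))
    (K₀ : ℕ) (hreg : ∀ K, K₀ ≤ K → ∀ t, |t| ≤ l₀ →
      1 - ∑ τ ∈ T K \ W K t, Real.sqrt ((A K t τ / ∑ σ ∈ T K \ W K t, A K t σ) * (B K t τ / ∑ σ ∈ T K \ W K t, B K t σ))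
        ≤ 1 / 16) :
    ∃ η : ℕ → ℝ, (∀ K, 0 ≤ η K) ∧ Summable (fun K => Real.sqrt (η K)) ∧
      ∀ K t, |t| ≤ l₀ →
        1 - ∑ τ ∈ T K, Real.sqrt ((A K t τ / ∑ σ ∈ T K, A K t σ) * (B K t τ / ∑ σ ∈ T K, B K t σ)) ≤ η K := by
  obtain ⟨wm, hwm, hws, hwildA, hwildB⟩ := wildMass_summable_pair
    (classWildMass_summable_of_refreshProcess T A hA W hW b hθ hΛθ hκ hC₀ UA wA ℓA PA hwA0 hwA hθPA hZA hmodelA)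
    (classWildMass_summable_of_refreshProcess T B hB W hW b hθ hΛθ hκ hC₀ UB wB ℓB PB hwB0 hwB hθPB hZB hmodelB)
  exact affinityDefectLetter_of_tameTilts T A B hA hB W hW wm hwm hwildA hwildB hws r hr hrs h𝔅 htilt K₀ hreg

/-- **★ COROLLARY — THE SUMMABLE HELLINGER RATE FROM TWO REFRESH PROCESSES AND TAME TILTS** [folklore]: under the hypotheses of
`affinityDefectLetter_of_refreshProcesses_and_tameTilts` there is a SUMMABLE `ρ ≥ 0` with `√(1 − Σ_{T K} √(p_{A,K,t}·p_{B,K,t})) ≤ ρ_K` for all `K`, `|t| ≤ l₀`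
(p618979 `exists_summable_sqrt_rate` BY NAME) — idea-3's `hellingerRate_of_tameTilts` conclusion with the (V‑a) binder discharged from the refresh-process letters. -/
theorem hellingerRate_of_refreshProcesses_and_tameTilts (T : ℕ → Finset ι) (A B : ℕ → ℝ → ι → ℝ)
    (hA : ∀ K t, |t| ≤ l₀ → ∀ τ ∈ T K, 0 < A K t τ) (hB : ∀ K t, |t| ≤ l₀ → ∀ τ ∈ T K, 0 < B K t τ)
    (W : ℕ → ℝ → Finset ι) (hW : ∀ K t, W K t ⊆ T K)
    {θ Λ ζ κ₁ Z₀ C₀ : ℝ} (b : ℝ) (hθ : 0 ≤ θ) (hΛθ : Λ + ζ < θ) (hκ : 2 < κ₁ * (θ - Λ - ζ)) (hC₀ : 0 ≤ C₀)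
    (UA UB : ℕ → ℝ → ℕ → Finset α) (wA ℓA PA wB ℓB PB : ℕ → ℝ → ℕ → α → ℝ)
    (hwA0 : ∀ K t m, ∀ j ∈ UA K t m, 0 ≤ wA K t m j) (hwB0 : ∀ K t m, ∀ j ∈ UB K t m, 0 ≤ wB K t m j)
    (hwA : ∀ K t m, ∀ j ∈ UA K t m, wA K t m j ≤ Real.exp (-PA K t m j))
    (hwB : ∀ K t m, ∀ j ∈ UB K t m, wB K t m j ≤ Real.exp (-PB K t m j))
    (hθPA : ∀ K t m, ∀ j ∈ UA K t m, θ * ℓA K t m j ≤ PA K t m j / 2)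
    (hθPB : ∀ K t m, ∀ j ∈ UB K t m, θ * ℓB K t m j ≤ PB K t m j / 2)
    (hZA : ∀ K t (m : ℕ), ∑ j ∈ UA K t m, Real.exp (-(PA K t m j / 2)) ≤ Z₀ + ζ * m)
    (hZB : ∀ K t (m : ℕ), ∑ j ∈ UB K t m, Real.exp (-(PB K t m j / 2)) ≤ Z₀ + ζ * m)
    (hmodelA : ∀ (K : ℕ) (t : ℝ), |t| ≤ l₀ → 1 ≤ K → ∀ s : ℝ,
      (∀ M : ℕ, ∑ m ∈ range M, (if b + κ₁ * Real.log (K : ℝ) ≤ (m : ℝ) then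
          Real.exp (Λ * m) * ∑ S ∈ (UA K t m).powerset with ((m : ℝ) - b ≤ ∑ j ∈ S, ℓA K t m j), ∏ j ∈ S, wA K t m j
        else 0) ≤ s) →
      (∑ τ ∈ W K t, A K t τ) / (∑ σ ∈ T K, A K t σ) ≤ C₀ * s)
    (hmodelB : ∀ (K : ℕ) (t : ℝ), |t| ≤ l₀ → 1 ≤ K → ∀ s : ℝ,
      (∀ M : ℕ, ∑ m ∈ range M, (if b + κ₁ * Real.log (K : ℝ) ≤ (m : ℝ) then
          Real.exp (Λ * m) * ∑ S ∈ (UB K t m).powerset with ((m : ℝ) - b ≤ ∑ j ∈ S, ℓB K t m j), ∏ j ∈ S, wB K t m j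
        else 0) ≤ s) →
      (∑ τ ∈ W K t, B K t τ) / (∑ σ ∈ T K, B K t σ) ≤ C₀ * s)
    (r : ℕ → ℝ) (hr : ∀ K, 0 < r K) (hrs : Summable fun K => 1 / r K)
    {𝔅 : ℝ} (h𝔅 : 0 ≤ 𝔅)
    (htilt : ∀ K t, |t| ≤ l₀ → ∃ φA φB : ℂ → ℂ,
      DifferentiableOn ℂ φA (Metric.closedBall 0 (r K)) ∧ DifferentiableOn ℂ φB (Metric.closedBall 0 (r K)) ∧
      (∀ s ∈ Metric.closedBall (0:ℂ) (r K), Complex.exp (φA s)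
        = (∑ τ ∈ T K \ W K t, (A K t τ : ℂ) * Complex.exp (s * ((Real.log (B K t τ) - Real.log (A K t τ) : ℝ) : ℂ)))
            / ∑ τ ∈ T K \ W K t, (A K t τ : ℂ)) ∧
      (∀ s ∈ Metric.closedBall (0:ℂ) (r K), Complex.exp (φB s)
        = (∑ τ ∈ T K \ W K t, (B K t τ : ℂ) * Complex.exp (s * ((Real.log (B K t τ) - Real.log (A K t τ) : ℝ) : ℂ)))
            / ∑ τ ∈ T K \ W K t, (B K t τ : ℂ)) ∧
      (∀ s ∈ Metric.closedBall (0:ℂ) (r K), ‖φA s‖ ≤ 𝔅) ∧ (∀ s ∈ Metric.closedBall (0:ℂ) (r K), ‖φB s‖ ≤ 𝔅))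
    (K₀ : ℕ) (hreg : ∀ K, K₀ ≤ K → ∀ t, |t| ≤ l₀ →
      1 - ∑ τ ∈ T K \ W K t, Real.sqrt ((A K t τ / ∑ σ ∈ T K \ W K t, A K t σ) * (B K t τ / ∑ σ ∈ T K \ W K t, B K t σ))
        ≤ 1 / 16) :
    ∃ ρ : ℕ → ℝ, Summable ρ ∧ (∀ K, 0 ≤ ρ K) ∧ ∀ K t, |t| ≤ l₀ →
      Real.sqrt (1 - ∑ τ ∈ T K, Real.sqrt ((A K t τ / ∑ σ ∈ T K, A K t σ) * (B K t τ / ∑ σ ∈ T K, B K t σ))) ≤ ρ K := by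
  obtain ⟨η, _, hs, hη⟩ := affinityDefectLetter_of_refreshProcesses_and_tameTilts T A B hA hB W hW b hθ hΛθ hκ hC₀
    UA UB wA ℓA PA wB ℓB PB hwA0 hwB0 hwA hwB hθPA hθPB hZA hZB hmodelA hmodelB r hr hrs h𝔅 htilt K₀ hreg
  exact exists_summable_sqrt_rate hs hη

end ClassWeights

/-! ## §7 PEIERLS DOMINATION — the SHAPE of the modelling letter `hmodel` at one birth depth, from a down-closed factorising weight system [folklore: the Peierls ∕
polymer-gas inequality «the weight of the configurations containing a given contour family is at most the product of its factors times the total weight»]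

v1.1 (edition note, NIT N2 of referee ref-Q g2 READ-55 ∕ dag-n20-w4 g3's CITE-FIRST advice; decls byte-identical).  PRIOR KERNEL OF THE SAME INEQUALITY IN THE TREE, by name:
`Literature.…Balaban1983to89.T4PeierlsDomination` — §1 `pinnedGas_total_le_prod_mul_good` (:142, `Z(Λ′ ∪ E) ≤ Π_{γ∈E}(1 + x γ)·Z(Λ′)` ⇒ `total ≤ Π_D(1+x)·good` for a
non-negative pinned polymer GAS) and §2 `sum_le_of_fibre_dom` (:215, the GAS-FREE erasure-map ∕ charge form «Σ_{Bad} ≤ weight·Σ_{total}»), with `T4HistoryPeeling` §2 carrying the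
single-slot insertion prices (`SlotDom`).  The theorems below state the domination for an abstract DOWN-CLOSED family `𝒜 : Finset (Finset β)` with the factorisation-WITH-DEFICIT
letter `A X ≤ (Π_{γ∈S} w γ)·A (X ∖ S)` and conclude in RELATIVE form against the spelled-out pattern sum of FILE 1 — a different binder shape serving idea-3's `hmodel`; they
were written before the kin was located (dag-n20-w4 g3, bus 2026-08-28 09:58Z) and are kept as the refresh-process road's own statement, the kin cited here. -/

section Peierls
variable {β : Type*} [DecidableEq β]

/-- [folklore] ONE PATTERN.  A DOWN-CLOSED finite family `𝒜` of refresh-event sets (sub-histories of admissible histories are admissible), weights `A ≥ 0` on `𝒜`,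
factors `w ≥ 0`, and the FACTORISATION-WITH-DEFICIT letter `A X ≤ (Π_{γ∈S} w γ)·A (X ∖ S)` for the sets `X ∈ 𝒜` containing `S` ⇒
`Σ_{X∈𝒜, S⊆X} A X ≤ (Π_S w)·Σ_{Y∈𝒜} A Y` (`X ↦ X ∖ S` is injective on `{X ⊇ S}` with image in `𝒜`). -/
theorem sum_superset_le_prod_mul_sum (𝒜 : Finset (Finset β)) (hdown : ∀ X ∈ 𝒜, ∀ Y, Y ⊆ X → Y ∈ 𝒜)
    (A : Finset β → ℝ) (hA : ∀ X ∈ 𝒜, 0 ≤ A X) (w : β → ℝ) (hw : ∀ γ, 0 ≤ w γ) (S : Finset β)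
    (hfac : ∀ X ∈ 𝒜, S ⊆ X → A X ≤ (∏ γ ∈ S, w γ) * A (X \ S)) :
    ∑ X ∈ 𝒜 with S ⊆ X, A X ≤ (∏ γ ∈ S, w γ) * ∑ Y ∈ 𝒜, A Y := by
  have hwS : 0 ≤ ∏ γ ∈ S, w γ := prod_nonneg fun γ _ => hw γ
  have hinj : Set.InjOn (fun X : Finset β => X \ S) ↑(𝒜.filter fun X => S ⊆ X) := by
    intro X hX X' hX' h
    have hSX : S ⊆ X := (mem_filter.1 (Finset.mem_coe.1 hX)).2
    have hSX' : S ⊆ X' := (mem_filter.1 (Finset.mem_coe.1 hX')).2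
    have e1 : X = X \ S ∪ S := (sdiff_union_of_subset hSX).symm
    have e2 : X' = X' \ S ∪ S := (sdiff_union_of_subset hSX').symm
    rw [e1, e2, show X \ S = X' \ S from h]
  have himg : (𝒜.filter fun X => S ⊆ X).image (fun X => X \ S) ⊆ 𝒜 := by
    intro Y hY
    obtain ⟨X, hX, rfl⟩ := mem_image.1 hY
    exact hdown X (mem_filter.1 hX).1 _ sdiff_subset
  calc ∑ X ∈ 𝒜 with S ⊆ X, A X ≤ ∑ X ∈ 𝒜 with S ⊆ X, (∏ γ ∈ S, w γ) * A (X \ S) :=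
        sum_le_sum fun X hX => hfac X (mem_filter.1 hX).1 (mem_filter.1 hX).2
    _ = (∏ γ ∈ S, w γ) * ∑ X ∈ 𝒜 with S ⊆ X, A (X \ S) := by rw [mul_sum]
    _ = (∏ γ ∈ S, w γ) * ∑ Y ∈ (𝒜.filter fun X => S ⊆ X).image (fun X => X \ S), A Y := by
        rw [sum_image hinj]
    _ ≤ (∏ γ ∈ S, w γ) * ∑ Y ∈ 𝒜, A Y :=
        mul_le_mul_of_nonneg_left (sum_le_sum_of_subset_of_nonneg himg fun Y hY _ => hA Y hY) hwS

/-- [folklore] A PATTERN FAMILY (union bound over `𝒮`, then the one-pattern bound): `Σ_{X∈𝒜, ∃S∈𝒮, S⊆X} A X ≤ (Σ_{S∈𝒮} Π_S w)·Σ_{Y∈𝒜} A Y`. -/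
theorem sum_exists_superset_le (𝒜 : Finset (Finset β)) (hdown : ∀ X ∈ 𝒜, ∀ Y, Y ⊆ X → Y ∈ 𝒜)
    (A : Finset β → ℝ) (hA : ∀ X ∈ 𝒜, 0 ≤ A X) (w : β → ℝ) (hw : ∀ γ, 0 ≤ w γ)
    (hfac : ∀ X ∈ 𝒜, ∀ S, S ⊆ X → A X ≤ (∏ γ ∈ S, w γ) * A (X \ S)) (𝒮 : Finset (Finset β)) :
    ∑ X ∈ 𝒜 with (∃ S ∈ 𝒮, S ⊆ X), A X ≤ (∑ S ∈ 𝒮, ∏ γ ∈ S, w γ) * ∑ Y ∈ 𝒜, A Y := by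
  have step1 : ∑ X ∈ 𝒜 with (∃ S ∈ 𝒮, S ⊆ X), A X
      ≤ ∑ X ∈ 𝒜, ∑ S ∈ 𝒮, (if S ⊆ X then A X else 0) := by
    rw [sum_filter]
    refine sum_le_sum fun X hX => ?_
    by_cases hP : ∃ S ∈ 𝒮, S ⊆ X
    · rw [if_pos hP]
      obtain ⟨S₀, hS₀, hS₀X⟩ := hP
      have h := single_le_sum (f := fun S => if S ⊆ X then A X else 0)
        (fun S _ => by split_ifs <;> first | exact hA X hX | exact le_rfl) hS₀
      simpa [if_pos hS₀X] using h
    · rw [if_neg hP]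
      exact sum_nonneg fun S _ => by split_ifs; exacts [hA X hX, le_rfl]
  have step2 : ∑ X ∈ 𝒜, ∑ S ∈ 𝒮, (if S ⊆ X then A X else 0)
      = ∑ S ∈ 𝒮, ∑ X ∈ 𝒜 with S ⊆ X, A X := by
    rw [sum_comm]
    refine sum_congr rfl fun S _ => ?_
    rw [sum_filter]
  rw [step2] at step1
  refine step1.trans ?_
  rw [sum_mul]
  exact sum_le_sum fun S _ => sum_superset_le_prod_mul_sum 𝒜 hdown A hA w hw S (fun X hX hSX => hfac X hX S hSX)

/-- **★★ `hmodel` AT ONE BIRTH DEPTH, FROM (KR) + PENDENCY** [folklore].  If every over-aged history (`Over X`, `X ∈ 𝒜`) CONTAINS a refresh pattern `S ⊆ U` whose epochs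
cover the over-age (`Δ ≤ Σ_{j∈S} ℓ j` — the memo's pendency lemma §3(b) as a deterministic containment), then under the down-closed factorising representation the
over-aged weight is at most the PATTERN SUM times the total weight: `Σ_{X∈𝒜, Over X} A X ≤ (Σ_{S ⊆ U, Δ ≤ Σ_S ℓ} Π_S w)·Σ_{Y∈𝒜} A Y`.  What stays a letter: the
representation ((KR) in this form), the containment, and the depth bookkeeping `C₀·e^{Λm}` of FILE 1's `hmodel`. -/
theorem overagedMass_le_patternSum_mul (𝒜 : Finset (Finset β)) (hdown : ∀ X ∈ 𝒜, ∀ Y, Y ⊆ X → Y ∈ 𝒜)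
    (A : Finset β → ℝ) (hA : ∀ X ∈ 𝒜, 0 ≤ A X) (w : β → ℝ) (hw : ∀ γ, 0 ≤ w γ)
    (hfac : ∀ X ∈ 𝒜, ∀ S, S ⊆ X → A X ≤ (∏ γ ∈ S, w γ) * A (X \ S))
    (U : Finset β) (ℓ : β → ℝ) (Δ : ℝ) (Over : Finset β → Prop) [DecidablePred Over]
    (hpend : ∀ X ∈ 𝒜, Over X → ∃ S, S ⊆ U ∧ Δ ≤ ∑ j ∈ S, ℓ j ∧ S ⊆ X) :
    ∑ X ∈ 𝒜 with Over X, A X ≤ (∑ S ∈ U.powerset with Δ ≤ ∑ j ∈ S, ℓ j, ∏ γ ∈ S, w γ) * ∑ Y ∈ 𝒜, A Y := by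
  have hsub : (𝒜.filter fun X => Over X) ⊆ 𝒜.filter fun X => ∃ S ∈ (U.powerset.filter fun S => Δ ≤ ∑ j ∈ S, ℓ j), S ⊆ X := by
    intro X hX
    rw [mem_filter] at hX ⊢
    obtain ⟨S, hSU, hΔ, hSX⟩ := hpend X hX.1 hX.2
    exact ⟨hX.1, S, by rw [mem_filter, mem_powerset]; exact ⟨hSU, hΔ⟩, hSX⟩
  calc ∑ X ∈ 𝒜 with Over X, A X ≤ ∑ X ∈ 𝒜 with (∃ S ∈ (U.powerset.filter fun S => Δ ≤ ∑ j ∈ S, ℓ j), S ⊆ X), A X :=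
        sum_le_sum_of_subset_of_nonneg hsub fun X hX _ => hA X (mem_filter.1 hX).1
    _ ≤ (∑ S ∈ U.powerset with Δ ≤ ∑ j ∈ S, ℓ j, ∏ γ ∈ S, w γ) * ∑ Y ∈ 𝒜, A Y :=
        sum_exists_superset_le 𝒜 hdown A hA w hw hfac _

/-- **★ RELATIVE FORM** [folklore]: under the same letters the RELATIVE over-aged mass `Σ_{X∈𝒜, Over X} A X ∕ Σ_{Y∈𝒜} A Y` is at most the pattern sum — the
one-depth, `C₀ = 1`, `Λ`-free instance of the quantity FILE 1's `hmodel` bounds (a vanishing total gives `0` on the left, Lean's `x ∕ 0 = 0`, and the pattern sum is `≥ 0`). -/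
theorem overagedRelMass_le_patternSum (𝒜 : Finset (Finset β)) (hdown : ∀ X ∈ 𝒜, ∀ Y, Y ⊆ X → Y ∈ 𝒜)
    (A : Finset β → ℝ) (hA : ∀ X ∈ 𝒜, 0 ≤ A X) (w : β → ℝ) (hw : ∀ γ, 0 ≤ w γ)
    (hfac : ∀ X ∈ 𝒜, ∀ S, S ⊆ X → A X ≤ (∏ γ ∈ S, w γ) * A (X \ S))
    (U : Finset β) (ℓ : β → ℝ) (Δ : ℝ) (Over : Finset β → Prop) [DecidablePred Over]
    (hpend : ∀ X ∈ 𝒜, Over X → ∃ S, S ⊆ U ∧ Δ ≤ ∑ j ∈ S, ℓ j ∧ S ⊆ X) :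
    (∑ X ∈ 𝒜 with Over X, A X) / (∑ Y ∈ 𝒜, A Y) ≤ ∑ S ∈ U.powerset with Δ ≤ ∑ j ∈ S, ℓ j, ∏ γ ∈ S, w γ := by
  have hPS : 0 ≤ ∑ S ∈ U.powerset with Δ ≤ ∑ j ∈ S, ℓ j, ∏ γ ∈ S, w γ :=
    sum_nonneg fun S _ => prod_nonneg fun γ _ => hw γ
  have htot : 0 ≤ ∑ Y ∈ 𝒜, A Y := sum_nonneg hA
  rcases htot.eq_or_lt with h0 | hpos
  · rw [← h0, div_zero]; exact hPS
  · rw [div_le_iff₀ hpos]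
    exact overagedMass_le_patternSum_mul 𝒜 hdown A hA w hw hfac U ℓ Δ Over hpend

/-- [toy] (A6) The PURE PRODUCT weight `A X = Π_X z` on ANY down-closed family satisfies the factorisation letter with `w = z` (equality) — the hard-core
polymer gas ∕ Peierls case; so §7's letters are jointly inhabited non-vacuously. -/
theorem toy_product_factorises (z : β → ℝ) (X S : Finset β) (hSX : S ⊆ X) :
    (∏ γ ∈ X, z γ) ≤ (∏ γ ∈ S, z γ) * ∏ γ ∈ X \ S, z γ := by
  rw [← prod_sdiff hSX, mul_comm]

end Peierls

/-! ## §6 Toys (A6): the letters are jointly inhabited, and the empty process has no over-age mass [bookkeeping] -/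

section Toys

/-- [toy] No refresh event ⇒ no over-age beyond the budget: the pattern sum at positive over-age vanishes. -/
theorem toy_patternSum_empty_pos (w ℓ : α → ℝ) {Δ : ℝ} (hΔ : 0 < Δ) :
    ∑ S ∈ (∅ : Finset α).powerset with Δ ≤ ∑ j ∈ S, ℓ j, ∏ j ∈ S, w j = 0 := by
  rw [powerset_empty]
  refine sum_eq_zero fun S hS => ?_
  rw [mem_filter, mem_singleton] at hS
  obtain ⟨rfl, h⟩ := hS
  rw [sum_empty] at h
  exact absurd h (not_le.2 hΔ)

/-- [toy] … and at over-age `0` it is the empty product `1` (the budget itself costs nothing: the memo's §3(a), reserve drawdown is prepaid). -/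
theorem toy_patternSum_empty_zero (w ℓ : α → ℝ) :
    ∑ S ∈ (∅ : Finset α).powerset with (0:ℝ) ≤ ∑ j ∈ S, ℓ j, ∏ j ∈ S, w j = 1 := by
  rw [powerset_empty]
  have : ({∅} : Finset (Finset α)).filter (fun S => (0:ℝ) ≤ ∑ j ∈ S, ℓ j) = {∅} := by
    ext S; simp only [mem_filter, mem_singleton, and_iff_left_iff_imp]; rintro rfl; simp
  rw [this, sum_singleton, prod_empty]

/-- [toy] The rate, entropy and block letters are jointly inhabited WITH ROOM in a caricature of print's regime: constant price `P = 20` per refresh, unit epochs,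
`θ = 10` (so `θ·ℓ ≤ P∕2`), per-event entropy `e^{−10}` (so `ζ = e^{−10}` serves `Σ_{j<m} e^{−P∕2} ≤ 0 + ζ m` on `U = range m`), block entropy `Λ = 4·log 2` (`L = 2`):
then `Λ + ζ < θ` and already `κ₁ := 1` gives `κ₁(θ − Λ − ζ) > 2`. -/
theorem toy_letters_inhabited :
    (4 * Real.log 2 + Real.exp (-10) < 10) ∧ (2 < 1 * (10 - 4 * Real.log 2 - Real.exp (-10))) ∧
      (∀ m : ℕ, ∑ _j ∈ range m, Real.exp (-((20:ℝ) / 2)) ≤ 0 + Real.exp (-10) * m) := by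
  have h2 : Real.log 2 < 0.6931471808 := Real.log_two_lt_d9
  have he : Real.exp (-10) ≤ 1 := Real.exp_le_one_iff.2 (by norm_num)
  refine ⟨by nlinarith, by nlinarith, fun m => ?_⟩
  rw [sum_const, card_range, nsmul_eq_mul]
  norm_num [mul_comm]

end Toys

end Summit.QuantumFields.YangMills.BalabanUVNodes.N20OverAgeRefreshProcessAtClassWeights

end
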